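import Summits.Ventures.Crystal3D.Theorems.StickyWulffConstantCoaxialWallLawOneFccLayerLines
import Summits.Ventures.Crystal3D.Theorems.StickyWulffConstantTextureLiminfTexShadowCertificateDefs
import HarnessLib

/-!
# The unit slice of a wall cell meets one layer slab in volume `≤ 2 d · m / S²` (`m` = sup of the half-chord·`S` over the cell) (F_layer OneFcc, flux (c))

HONEST FRAMING. Venture `Summits/Ventures/Crystal3D` (cell `crystal3d-full`); helper `--supports` the crux `CoaxialWallLaw`
(stmt-Ventures-19481, REGISTERED line `WallLedgerF`) in its role as owner of lane T's debt T-F2 / F_layer, OneFcc half; memo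
HOME/wall-19481-p1/g16/TWO-FAMILY-LEDGER-g16.md §Ledger (charge side).  Pure measure theory / linear algebra, standard axioms; nothing about
the crux is claimed; F-C1 not moved.

THE ESTIMATE.  For a frame `L` with origin `s` (`ν = L⁻¹ e₃`, `S² = 1 − ν₂² > 0`, model layer height `c_i = i d + (L⁻¹ s)₂`, `d = √(2/3)`) the
unit slice `{0 ≤ x₂ ≤ 1, x₀² + x₁² ≤ ρ'²}` meets the open layer slab `laySlab L s i` inside the pull-back of the box
`⟪P, ν⟫ ∈ [0, 1]`, `P₂ ∈ [c_i, c_i + d]`, `⟪P, τ'⟫ ∈ [−m, m]` (`τ' = (−ν₁, ν₀, 0)`) under the linear map `P ↦ (⟪P,ν⟫, P₂, ⟪P,τ'⟫)` (built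
inline, determinant `−S²` by `Matrix.det_fin_three`), as soon as `m ≥ 0` dominates `ρ'² S² − (c − z ν₂)²` over the cell `(c, z) ∈ [c_i, c_i + d] × [0, 1]` — because
`S²·lateral² = ⟪P, τ'⟫² + (P₂ − x₂ ν₂)²` (`ap_disc_identity`).  Hence
**`volume_slice_inter_laySlab_le`**: `|slice(ρ') ∩ laySlab L s i| ≤ 2 d m / S²`  (`= (d/S)·sup chord`, the charge-side currency of the ledger:
`sin θ · |slice ∩ slab| ≤ d · chord`).
WHAT THIS IS NOT: not the sum over slabs, not the comparison with the line counts; F-C1 not moved.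
-/

noncomputable section

namespace Summit.Ventures.Crystal3D.Theorems

open Summit.Ventures.Crystal3D Finset MeasureTheory
open Literature.Algebra.EuclideanLattices (inner_fin_three norm_sq_fin_three)
open Summit.Ventures.Crystal3D.Cruxes.TextureLiminf.TexShadow (laySlab)
open scoped InnerProductSpace

/-- **THE SLAB-VOLUME ESTIMATE.**  See the module docstring. -/
theorem volume_slice_inter_laySlab_le (L : EuclideanSpace ℝ (Fin 3) ≃ₗᵢ[ℝ] EuclideanSpace ℝ (Fin 3))
    (s : EuclideanSpace ℝ (Fin 3)) (i : ℤ) (ρ' m : ℝ) (hm : 0 ≤ m)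
    (hS : 0 < 1 - (L.symm (EuclideanSpace.single (2 : Fin 3) (1 : ℝ))) 2 ^ 2)
    (hcell : ∀ c z : ℝ, (i : ℝ) * Real.sqrt (2 / 3) + (L.symm s) 2 ≤ c → c ≤ ((i : ℝ) + 1) * Real.sqrt (2 / 3) + (L.symm s) 2 →
      0 ≤ z → z ≤ 1 →
      ρ' ^ 2 * (1 - (L.symm (EuclideanSpace.single (2 : Fin 3) (1 : ℝ))) 2 ^ 2) -
        (c - z * (L.symm (EuclideanSpace.single (2 : Fin 3) (1 : ℝ))) 2) ^ 2 ≤ m ^ 2) :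
    volume ({q : EuclideanSpace ℝ (Fin 3) | 0 ≤ q 2 ∧ q 2 ≤ 1 ∧ q 0 ^ 2 + q 1 ^ 2 ≤ ρ' ^ 2} ∩ laySlab L s i) ≤
      ENNReal.ofReal (2 * Real.sqrt (2 / 3) * m / (1 - (L.symm (EuclideanSpace.single (2 : Fin 3) (1 : ℝ))) 2 ^ 2)) := by
  set e₃ : EuclideanSpace ℝ (Fin 3) := EuclideanSpace.single (2 : Fin 3) (1 : ℝ) with he₃
  set ν : EuclideanSpace ℝ (Fin 3) := L.symm e₃ with hν
  set s' : EuclideanSpace ℝ (Fin 3) := L.symm s with hs'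
  set dd : ℝ := Real.sqrt (2 / 3) with hdd
  have hdd0 : 0 ≤ dd := Real.sqrt_nonneg _
  have hνn : ‖ν‖ = 1 := by rw [hν, LinearIsometryEquiv.norm_map, he₃, PiLp.norm_single, norm_one]
  have hν1 : ν 0 ^ 2 + ν 1 ^ 2 + ν 2 ^ 2 = 1 := by rw [← norm_sq_fin_three, hνn, one_pow]
  set S2 : ℝ := 1 - ν 2 ^ 2 with hS2
  have hS2' : S2 = ν 0 ^ 2 + ν 1 ^ 2 := by rw [hS2]; linarith
  have hS2pos : 0 < S2 := hS
  -- the transverse horizontal vector `τ' = (−ν₁, ν₀, 0)`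
  set τ' : EuclideanSpace ℝ (Fin 3) := EuclideanSpace.single (0 : Fin 3) (-(ν 1)) + EuclideanSpace.single (1 : Fin 3) (ν 0)
    with hτ'
  have hτ0 : τ' 0 = -ν 1 := by simp [hτ']
  have hτ1 : τ' 1 = ν 0 := by simp [hτ']
  have hτ2 : τ' 2 = 0 := by simp [hτ']
  -- the box and its pull-back
  set c₀ : ℝ := (i : ℝ) * dd + s' 2 with hc₀
  set lo : EuclideanSpace ℝ (Fin 3) := EuclideanSpace.single (1 : Fin 3) c₀ + EuclideanSpace.single (2 : Fin 3) (-m) with hlo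
  set hi : EuclideanSpace ℝ (Fin 3) := EuclideanSpace.single (0 : Fin 3) (1 : ℝ) + EuclideanSpace.single (1 : Fin 3) (c₀ + dd) +
    EuclideanSpace.single (2 : Fin 3) m with hhi
  have hlo0 : lo 0 = 0 := by simp [hlo]
  have hlo1 : lo 1 = c₀ := by simp [hlo]
  have hlo2 : lo 2 = -m := by simp [hlo]
  have hhi0 : hi 0 = 1 := by simp [hhi]
  have hhi1 : hi 1 = c₀ + dd := by simp [hhi]
  have hhi2 : hi 2 = m := by simp [hhi]
  set Box : Set (EuclideanSpace ℝ (Fin 3)) := (WithLp.ofLp : EuclideanSpace ℝ (Fin 3) → (Fin 3 → ℝ)) ⁻¹'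
    Set.Icc (WithLp.ofLp lo) (WithLp.ofLp hi) with hBox
  have hmemBox : ∀ y : EuclideanSpace ℝ (Fin 3), (0 ≤ y 0 ∧ y 0 ≤ 1) → (c₀ ≤ y 1 ∧ y 1 ≤ c₀ + dd) → (-m ≤ y 2 ∧ y 2 ≤ m) → y ∈ Box := by
    intro y h0 h1 h2
    rw [hBox, Set.mem_preimage, Set.mem_Icc]
    refine ⟨fun k => ?_, fun k => ?_⟩
    · fin_cases k
      · show lo 0 ≤ y 0; rw [hlo0]; exact h0.1
      · show lo 1 ≤ y 1; rw [hlo1]; exact h1.1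
      · show lo 2 ≤ y 2; rw [hlo2]; exact h2.1
    · fin_cases k
      · show y 0 ≤ hi 0; rw [hhi0]; exact h0.2
      · show y 1 ≤ hi 1; rw [hhi1]; exact h1.2
      · show y 2 ≤ hi 2; rw [hhi2]; exact h2.2
  have hvolBox : volume Box = ENNReal.ofReal (2 * dd * m) := by
    rw [hBox, (PiLp.volume_preserving_ofLp (Fin 3)).measure_preimage measurableSet_Icc.nullMeasurableSet,
      Real.volume_Icc_pi, Fin.prod_univ_three]
    change ENNReal.ofReal (hi 0 - lo 0) * ENNReal.ofReal (hi 1 - lo 1) * ENNReal.ofReal (hi 2 - lo 2) = _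
    rw [hhi0, hlo0, hhi1, hlo1, hhi2, hlo2, ← ENNReal.ofReal_mul (by norm_num), ← ENNReal.ofReal_mul (by
      nlinarith)]
    congr 1; ring
  -- the linear map `P ↦ (⟪ν, P⟫, P₂, ⟪τ', P⟫)` and its determinant `−S²`
  set Φ : EuclideanSpace ℝ (Fin 3) →ₗ[ℝ] EuclideanSpace ℝ (Fin 3) :=
    (innerₗ (EuclideanSpace ℝ (Fin 3)) ν).smulRight (EuclideanSpace.single (0 : Fin 3) (1 : ℝ)) +
      (EuclideanSpace.proj (2 : Fin 3)).toLinearMap.smulRight (EuclideanSpace.single (1 : Fin 3) (1 : ℝ)) +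
      (innerₗ (EuclideanSpace ℝ (Fin 3)) τ').smulRight (EuclideanSpace.single (2 : Fin 3) (1 : ℝ)) with hΦ
  have hΦcoord : ∀ P : EuclideanSpace ℝ (Fin 3), Φ P 0 = ⟪ν, P⟫_ℝ ∧ Φ P 1 = P 2 ∧ Φ P 2 = ⟪τ', P⟫_ℝ := by
    intro P; simp [hΦ, LinearMap.smulRight_apply]
  have hdet : LinearMap.det Φ = -S2 := by
    classical
    rw [← LinearMap.det_toMatrix (EuclideanSpace.basisFun (Fin 3) ℝ).toBasis, Matrix.det_fin_three]
    have hentry : ∀ k j : Fin 3, LinearMap.toMatrix (EuclideanSpace.basisFun (Fin 3) ℝ).toBasis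
        (EuclideanSpace.basisFun (Fin 3) ℝ).toBasis Φ k j = Φ (EuclideanSpace.single j 1) k := by
      intro k j
      rw [LinearMap.toMatrix_apply, OrthonormalBasis.coe_toBasis_repr_apply, EuclideanSpace.basisFun_repr,
        OrthonormalBasis.coe_toBasis, EuclideanSpace.basisFun_apply]
    simp only [hentry]
    have h0 := hΦcoord (EuclideanSpace.single 0 1)
    have h1 := hΦcoord (EuclideanSpace.single 1 1)
    have h2 := hΦcoord (EuclideanSpace.single 2 1)
    simp only [EuclideanSpace.inner_single_right, PiLp.single_apply] at h0 h1 h2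
    simp only [Fin.isValue, ↓reduceIte, Fin.reduceEq, conj_trivial, one_mul] at h0 h1 h2
    rw [h0.1, h0.2.1, h0.2.2, h1.1, h1.2.1, h1.2.2, h2.1, h2.2.1, h2.2.2, hτ0, hτ1, hS2']
    ring
  have hdet0 : LinearMap.det Φ ≠ 0 := by rw [hdet]; linarith
  -- containment: the slice ∩ slab pulls back (by `L⁻¹`) into `Φ⁻¹ Box`
  have hsub : {q : EuclideanSpace ℝ (Fin 3) | 0 ≤ q 2 ∧ q 2 ≤ 1 ∧ q 0 ^ 2 + q 1 ^ 2 ≤ ρ' ^ 2} ∩ laySlab L s i ⊆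
      (L.symm : EuclideanSpace ℝ (Fin 3) → EuclideanSpace ℝ (Fin 3)) ⁻¹' (Φ ⁻¹' Box) := by
    rintro x ⟨⟨hx0, hx1, hxlat⟩, hxslab⟩
    rw [Set.mem_preimage, Set.mem_preimage]
    set P : EuclideanSpace ℝ (Fin 3) := L.symm x with hP
    -- slab coordinate
    obtain ⟨y, ⟨hy1, hy2⟩, hyx⟩ := hxslab
    have hP2 : P 2 = y 2 + s' 2 := by
      have : P = y + s' := by rw [hP, ← hyx, map_add, LinearIsometryEquiv.symm_apply_apply, hs']
      rw [this, PiLp.add_apply]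
    -- height and lateral
    have hPν : ⟪ν, P⟫_ℝ = x 2 := by
      rw [hP, hν, LinearIsometryEquiv.inner_map_map, real_inner_comm, inner_single_two_one]
    have hPnorm : ‖P‖ = ‖x‖ := by rw [hP, LinearIsometryEquiv.norm_map]
    have hlat : ‖P‖ ^ 2 - (x 2) ^ 2 = x 0 ^ 2 + x 1 ^ 2 := by rw [hPnorm, sq_add_sq_eq_norm_sq_sub, inner_single_two_one]
    have hz : x 2 = P 0 * ν 0 + P 1 * ν 1 + P 2 * ν 2 := by rw [← hPν, real_inner_comm, inner_fin_three]
    have hid := ap_disc_identity (P 0) (P 1) (P 2) (ν 0) (ν 1) (ν 2) (x 2) hν1 hz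
    have hPτ : ⟪τ', P⟫_ℝ = P 1 * ν 0 - P 0 * ν 1 := by rw [inner_fin_three, hτ0, hτ1, hτ2]; ring
    have hcellP := hcell (P 2) (x 2) (by rw [hP2, hc₀]; linarith) (by rw [hP2]; linarith) hx0 hx1
    have hτsq : ⟪τ', P⟫_ℝ ^ 2 ≤ m ^ 2 := by
      rw [hPτ]
      have hnormP := norm_sq_fin_three P
      have hxlat' : P 0 ^ 2 + P 1 ^ 2 + P 2 ^ 2 - x 2 ^ 2 ≤ ρ' ^ 2 := by linarith
      have hS2nn : 0 ≤ ν 0 ^ 2 + ν 1 ^ 2 := by positivity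
      have h1 := mul_le_mul_of_nonneg_left hxlat' hS2nn
      rw [hS2'] at hcellP
      linarith [hid, hcellP, h1]
    obtain ⟨hm1, hm2⟩ := abs_le_of_sq_le_sq' hτsq hm
    obtain ⟨e0, e1, e2⟩ := hΦcoord P
    refine hmemBox (Φ P) ?_ ?_ ?_
    · rw [e0, hPν]; exact ⟨hx0, hx1⟩
    · rw [e1, hP2, hc₀]; constructor <;> linarith
    · rw [e2]; exact ⟨hm1, hm2⟩
  -- volumes
  have hmeasBox : MeasurableSet Box := by
    rw [hBox]; exact measurableSet_Icc.preimage (PiLp.volume_preserving_ofLp (Fin 3)).measurable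
  have hmeasPre : MeasurableSet (Φ ⁻¹' Box) := hmeasBox.preimage Φ.continuous_of_finiteDimensional.measurable
  calc volume ({q : EuclideanSpace ℝ (Fin 3) | 0 ≤ q 2 ∧ q 2 ≤ 1 ∧ q 0 ^ 2 + q 1 ^ 2 ≤ ρ' ^ 2} ∩ laySlab L s i)
      ≤ volume ((L.symm : EuclideanSpace ℝ (Fin 3) → EuclideanSpace ℝ (Fin 3)) ⁻¹' (Φ ⁻¹' Box)) := measure_mono hsub
    _ = volume (Φ ⁻¹' Box) := (L.symm.measurePreserving).measure_preimage hmeasPre.nullMeasurableSet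
    _ = ENNReal.ofReal |(LinearMap.det Φ)⁻¹| * volume Box := MeasureTheory.Measure.addHaar_preimage_linearMap _ hdet0 _
    _ = ENNReal.ofReal (2 * dd * m / S2) := by
        rw [hvolBox, hdet, inv_neg, abs_neg, abs_of_pos (inv_pos.2 hS2pos), ← ENNReal.ofReal_mul (by positivity)]
        congr 1
        field_simp

end Summit.Ventures.Crystal3D.Theorems

end
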